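import Summits.KontsevichZagierPeriods.KontsevichZagierPeriods.Theses.IsogenyCertificates
import Summits.KontsevichZagierPeriods.KontsevichZagierPeriods.Theorems.XMapKernel.Negative.Core
import Summits.KontsevichZagierPeriods.KontsevichZagierPeriods.Theorems.IsogenyCertificatesXMapKernelIffSummit
import Summits.KontsevichZagierPeriods.KontsevichZagierPeriods.Theorems.IsogenyCertificatesAlgebraicModuliRealPeriodCell
import Literature.NumberTheory.Transcendental.KZRelationsLE
import Literature.NumberTheory.Transcendental.KZCalculusProofs

/-!
# Strategist sketch r2 — crux `XMapKernelOfCells` (stmt-KontsevichZagierPeriods-18976), route IsogenyCertificates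

Seat `cstrat-stmt-KontsevichZagierPeriods-18976-r1` (2026-08-17), companion of
`Cruxes/XMapKernelOfCells/STRATEGY-CENSUS.md` (census r2). Kernel-checked content, no `sorry`:

* §1 **the remainder today.** With the cell `AlgebraicModuliRealPeriodCell` LANDED
  (`AlgRealPeriodCell.AlgebraicModuliRealPeriodCell_of`, p144507) and `GenusTwoRealPeriodCell →
  BiellipticRealPeriodCell` (closure monotonicity), the crux IS `GenusTwoRealPeriodCell → XMapKernel`,
  i.e. Conjecture 1 relative to ONE proper sector (`remainder_iff_genusTwo_imp_summit`).
* §2 **proper sub-kernels (the human's probes, 2026-08-17 07:4x).** `CellKernel S` := Conjecture 1 in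
  kernel form on a sector `S`. Every sector statement is a consequence of the summit
  (`cellKernel_of_summit`), sub-sectors inherit cells (`cellKernel_anti`) — so the CM / non-CM seams of the
  landed real-algebraic cell are CLOSED, and the genus-2 / bielliptic / real-algebraic cells are sub-cells
  of the dimension-one cell `HeadCell 1` (`genusTwo_of_headCell_one`, …).
* §3 **the dimension-of-the-motive seam, typed.** `HeadCell d` (all representations of ambient dimension
  `≤ d`), the bridge tail `Cofinal d := HeadCell d → XMapKernel`, and the better-typed co-final piece
  `AdjoinedKernel d` (Conjecture 1 with ALL period relations of dimension `≤ d` adjoined as axioms;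
  `↔ ReducesTo (formalRepLE d)`, the remainder shape of census r1). Assemblies PROVED
  (`remainder_of_headCell_of_cofinal`, `remainder_of_headCell_of_adjoined` — trivial seams, flagged), prices
  PROVED (`cofinal_iff_summit_of_headCell`, `adjoined_iff_summit_of_headCell`: the co-final piece is the
  summit the day its head lands), exhaustion PROVED (`xMapKernel_iff_forall_headCell`: the kernel conjecture
  is the conjunction of the proper sub-kernels `HeadCell d`, an INFINITE ascending chain).
* §4 **co-bounded dimension is not proper.** For every `d₀`, Conjecture 1 on the sector generated by the
  representations of dimension `≥ d₀` is ALREADY the whole kernel conjecture (`coBounded_iff_xMapKernel`):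
  every representation climbs in dimension by Newton–Leibniz slabs (`KZ.IntegralRep.exists_equivalent_add`).
  Only bounded-above dimension sectors are proper; "beyond dimension one" cannot be cut off from above.

Nothing here has a route decl as a bare conclusion except from hypotheses that are themselves pieces.
-/

noncomputable section

set_option linter.dupNamespace false

namespace Summit.KontsevichZagierPeriods.KontsevichZagierPeriods.Cruxes.XMapKernelOfCells.Seams

open Literature.NumberTheory.Transcendental
open Summit.KontsevichZagierPeriods.KontsevichZagierPeriods.Theses.IsogenyCertificates
open Summit.KontsevichZagierPeriods.XMapKernel.Negative
open Summit.KontsevichZagierPeriods.IsogenyCertificates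

/-! ## §0 Vocabulary -/

/-- Conjecture 1 in kernel form on a sector `S ≤ FormalRep` (a CELL; a proper sub-kernel when `S ≠ ⊤`). -/
def CellKernel (S : AddSubgroup KZ.FormalRep) : Prop :=
  ∀ c ∈ S, KZ.eval c = 0 → c ∈ KZ.relations

/-- The dimension-`≤ d` sector: Conjecture 1 for formal combinations of representations of ambient
dimension `≤ d` (chains through any dimension allowed). `HeadCell 1` = all real 1-dimensional
representations = the Huber–Wüstholz sector. -/
def HeadCell (d : ℕ) : Prop := CellKernel (KZ.formalRepLE d)

/-- The bridge tail of the dimension seam. -/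
def Cofinal (d : ℕ) : Prop := HeadCell d → XMapKernel

/-- Kernel elements of dimension `≤ d` (the period relations among `≤ d`-dimensional representations). -/
def kerLE (d : ℕ) : Set KZ.FormalRep := {c | c ∈ KZ.formalRepLE d ∧ KZ.eval c = 0}

/-- **Conjecture 1 with all `≤ d`-dimensional period relations adjoined**: every kernel element lies in the
subgroup generated by the four moves and `kerLE d`. The co-final piece in "adjoined relators" form. -/
def AdjoinedKernel (d : ℕ) : Prop :=
  ∀ c : KZ.FormalRep, KZ.eval c = 0 → c ∈ AddSubgroup.closure ((moves : Set KZ.FormalRep) ∪ kerLE d)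

/-- The remainder shape of census r1: kernel elements reduce to the sector `S` modulo relations. -/
def ReducesTo (S : AddSubgroup KZ.FormalRep) : Prop :=
  ∀ c : KZ.FormalRep, KZ.eval c = 0 → ∃ c' ∈ S, c - c' ∈ KZ.relations

/-- The kernel form of the summit, recalled. -/
theorem xMapKernel_iff_kernel : XMapKernel ↔ ∀ c : KZ.FormalRep, KZ.eval c = 0 → c ∈ KZ.relations := by
  rw [crux_iff, XMapKernelIffSummit.closure_gens_eq_relations_holds]

theorem kernel_iff_summit : (∀ c : KZ.FormalRep, KZ.eval c = 0 → c ∈ KZ.relations) ↔ _root_.KontsevichZagierPeriods :=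
  xMapKernel_iff_kernel.symm.trans XMapKernelIffSummit.xMapKernel_iff_summit

theorem eval_eq_zero_of_mem_relations {c : KZ.FormalRep} (hc : c ∈ KZ.relations) : KZ.eval c = 0 :=
  AddMonoidHom.mem_ker.1 (KZ.relations_le_ker_eval_holds hc)

/-! ## §1 The remainder today: Conjecture 1 relative to the genus-two sector -/

/-- The real-algebraic-moduli cell is a THEOREM of the tree (p144507). -/
theorem cellA_holds : AlgebraicModuliRealPeriodCell := AlgRealPeriodCell.AlgebraicModuliRealPeriodCell_of

/-- The bielliptic sector is a sub-sector of the genus-two sector (`F := G ∘ X²`, degree 6). -/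
theorem bielliptic_of_genusTwo : GenusTwoRealPeriodCell → BiellipticRealPeriodCell := by
  intro hG c hc h0
  refine hG c (AddSubgroup.closure_mono ?_ hc) h0
  rintro d ⟨G, q, a₀, a₁, r, hdeg, hsq, hpos, -, hdom, hint, rfl⟩
  refine ⟨G.comp (Polynomial.X ^ 2), q, a₀, a₁, r, hsq, Or.inr ?_, hpos, hdom, hint, rfl⟩
  rw [Polynomial.natDegree_comp, hdeg, Polynomial.natDegree_X_pow]

/-- **The crux today is `GenusTwoRealPeriodCell → XMapKernel`.** -/
theorem remainder_iff_genusTwo : XMapKernelOfCells ↔ (GenusTwoRealPeriodCell → XMapKernel) :=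
  ⟨fun h hG => h cellA_holds hG (bielliptic_of_genusTwo hG), fun h _ hG _ => h hG⟩

/-- … i.e. Conjecture 1 relative to ONE proper sector (the genus-two real half-periods over ℚ). -/
theorem remainder_iff_genusTwo_imp_summit :
    XMapKernelOfCells ↔ (GenusTwoRealPeriodCell → _root_.KontsevichZagierPeriods) :=
  remainder_iff_genusTwo.trans (imp_congr Iff.rfl XMapKernelIffSummit.xMapKernel_iff_summit)

/-- The summit gives the remainder (never stronger than S). -/
theorem remainder_of_summit : _root_.KontsevichZagierPeriods → XMapKernelOfCells :=
  fun hs _ _ _ => XMapKernelIffSummit.xMapKernel_iff_summit.2 hs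

/-! ## §2 Proper sub-kernels: every cell is a consequence of S; sub-sectors inherit cells -/

theorem cellKernel_of_summit (S : AddSubgroup KZ.FormalRep) : _root_.KontsevichZagierPeriods → CellKernel S :=
  fun hs c _ h0 => kernel_iff_summit.2 hs c h0

theorem cellKernel_of_xMapKernel (S : AddSubgroup KZ.FormalRep) : XMapKernel → CellKernel S :=
  fun hX c _ h0 => xMapKernel_iff_kernel.1 hX c h0

/-- Sub-sectors inherit cells: in particular the CM and the non-CM sub-sectors of the LANDED cell
`AlgebraicModuliRealPeriodCell` are closed with it — no bet is left on the CM / non-CM seam in genus one. -/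
theorem cellKernel_anti {S T : AddSubgroup KZ.FormalRep} (h : T ≤ S) (hS : CellKernel S) : CellKernel T :=
  fun c hc h0 => hS c (h hc) h0

/-- The whole space is the improper sector. -/
theorem cellKernel_top_iff : CellKernel ⊤ ↔ XMapKernel := by
  rw [xMapKernel_iff_kernel]
  exact ⟨fun h c h0 => h c trivial h0, fun h c _ h0 => h c h0⟩

theorem headCell_mono {d d' : ℕ} (h : d ≤ d') : HeadCell d' → HeadCell d :=
  cellKernel_anti (KZ.formalRepLE_mono h)

theorem headCell_of_xMapKernel (d : ℕ) : XMapKernel → HeadCell d := cellKernel_of_xMapKernel _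

theorem headCell_of_summit (d : ℕ) : _root_.KontsevichZagierPeriods → HeadCell d := cellKernel_of_summit _

/-- The genus-two sector is a sub-sector of dimension one. -/
theorem genusTwo_of_headCell_one : HeadCell 1 → GenusTwoRealPeriodCell := by
  intro h c hc h0
  refine h c ((AddSubgroup.closure_le _).2 ?_ hc) h0
  rintro d ⟨F, q, a₀, a₁, r, -, -, -, -, -, rfl⟩
  exact KZ.of_mem_formalRepLE r le_rfl

/-- The bielliptic sector is a sub-sector of dimension one. -/
theorem bielliptic_of_headCell_one : HeadCell 1 → BiellipticRealPeriodCell := by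
  intro h c hc h0
  refine h c ((AddSubgroup.closure_le _).2 ?_ hc) h0
  rintro d ⟨G, q, a₀, a₁, r, -, -, -, -, -, -, rfl⟩
  exact KZ.of_mem_formalRepLE r le_rfl

/-- The real-algebraic-moduli sector is a sub-sector of dimension one (recorded; it is landed anyway). -/
theorem algModuli_of_headCell_one : HeadCell 1 → AlgebraicModuliRealPeriodCell := by
  intro h c hc h0
  refine h c ((AddSubgroup.closure_le _).2 ?_ hc) h0
  rintro d ⟨α, β, a, r, -, -, -, -, -, -, rfl⟩
  exact KZ.of_mem_formalRepLE r le_rfl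

/-- Hence the three cells of the crux are ONE consequence of the dimension-one cell. -/
theorem cells_of_headCell_one (h : HeadCell 1) :
    AlgebraicModuliRealPeriodCell ∧ GenusTwoRealPeriodCell ∧ BiellipticRealPeriodCell :=
  ⟨algModuli_of_headCell_one h, genusTwo_of_headCell_one h, bielliptic_of_headCell_one h⟩

/-! ## §3 The dimension seam: assemblies, prices, exhaustion -/

/-- Every formal combination is supported in some bounded dimension. -/
theorem exists_mem_formalRepLE (c : KZ.FormalRep) : ∃ d, c ∈ KZ.formalRepLE d := by
  have hdir : Directed (· ≤ ·) KZ.formalRepLE :=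
    Monotone.directed_le fun _ _ h => KZ.formalRepLE_mono h
  exact (AddSubgroup.mem_iSup_of_directed hdir).1 (KZ.mem_iSup_formalRepLE c)

/-- **Exhaustion.** The kernel conjecture is the conjunction of its proper sub-kernels `HeadCell d` — an
infinite ascending chain (`headCell_mono`). Any FINITE set of them is implied by one `HeadCell d₀`. -/
theorem xMapKernel_iff_forall_headCell : XMapKernel ↔ ∀ d, HeadCell d := by
  refine ⟨fun hX d => headCell_of_xMapKernel d hX, fun h => ?_⟩
  rw [xMapKernel_iff_kernel]
  intro c h0
  obtain ⟨d, hd⟩ := exists_mem_formalRepLE c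
  exact h d c hd h0

/-- The bridge tail unfolded: `Cofinal d` is "S relative to the dimension-`≤ d` sector". -/
theorem cofinal_iff (d : ℕ) : Cofinal d ↔ (HeadCell d → _root_.KontsevichZagierPeriods) :=
  imp_congr Iff.rfl XMapKernelIffSummit.xMapKernel_iff_summit

theorem cofinal_of_summit (d : ℕ) : _root_.KontsevichZagierPeriods → Cofinal d :=
  fun hs _ => XMapKernelIffSummit.xMapKernel_iff_summit.2 hs

/-- **Assembly of the bridge split** (trivial seam — modus ponens; flagged `trivial_seam`). -/
theorem xMapKernel_of_headCell_of_cofinal (d : ℕ) : HeadCell d → Cofinal d → XMapKernel :=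
  fun hH hC => hC hH

/-- **Assembly into the crux** `XMapKernelOfCells` (trivial seam). -/
theorem remainder_of_headCell_of_cofinal (d : ℕ) : HeadCell d → Cofinal d → XMapKernelOfCells :=
  fun hH hC _ _ _ => hC hH

/-- **Price of the bridge split.** The day `HeadCell d` lands, `Cofinal d` IS the summit. -/
theorem cofinal_iff_summit_of_headCell (d : ℕ) (hH : HeadCell d) : Cofinal d ↔ _root_.KontsevichZagierPeriods :=
  ⟨fun hC => XMapKernelIffSummit.xMapKernel_iff_summit.1 (hC hH), cofinal_of_summit d⟩

/-- **The crux implies the tail at every `d ≥ 1`**: the crux's three cells are sub-cells of `HeadCell 1`,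
so `XMapKernelOfCells → Cofinal d` for `1 ≤ d` — the tail is a CONSEQUENCE of the crux (and of S), the
head is a consequence of S; the converse `Cofinal d → XMapKernelOfCells` is NOT available short of S
(the cells do not give `HeadCell d` back): probed in `Probes.lean`. -/
theorem cofinal_of_remainder {d : ℕ} (hd : 1 ≤ d) : XMapKernelOfCells → Cofinal d := fun hR hH =>
  hR (algModuli_of_headCell_one (headCell_mono hd hH)) (genusTwo_of_headCell_one (headCell_mono hd hH))
    (bielliptic_of_headCell_one (headCell_mono hd hH))

/-- Hence, GIVEN the head, crux, tail and summit coincide. -/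
theorem remainder_iff_summit_of_headCell {d : ℕ} (hd : 1 ≤ d) (hH : HeadCell d) :
    XMapKernelOfCells ↔ _root_.KontsevichZagierPeriods :=
  ⟨fun hR => (cofinal_iff_summit_of_headCell d hH).1 (cofinal_of_remainder hd hR), remainder_of_summit⟩

/-! ### The adjoined-relators form of the co-final piece -/

theorem moves_subset_closure_adjoined (d : ℕ) :
    (moves : Set KZ.FormalRep) ⊆ AddSubgroup.closure ((moves : Set KZ.FormalRep) ∪ kerLE d) :=
  fun _ hm => AddSubgroup.subset_closure (Or.inl hm)

theorem relations_le_closure_adjoined (d : ℕ) :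
    KZ.relations ≤ AddSubgroup.closure ((moves : Set KZ.FormalRep) ∪ kerLE d) := by
  rw [relations_eq_closure_moves]
  exact AddSubgroup.closure_mono Set.subset_union_left

/-- With the head cell, the adjoined relators are honest relations. -/
theorem closure_adjoined_eq_relations_of_headCell (d : ℕ) (hH : HeadCell d) :
    AddSubgroup.closure ((moves : Set KZ.FormalRep) ∪ kerLE d) = KZ.relations := by
  refine le_antisymm ?_ (relations_le_closure_adjoined d)
  rw [AddSubgroup.closure_le]
  rintro c (hc | ⟨hc, h0⟩)
  · rw [relations_eq_closure_moves]
    exact AddSubgroup.subset_closure hc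
  · exact hH c hc h0

theorem adjoined_of_summit (d : ℕ) : _root_.KontsevichZagierPeriods → AdjoinedKernel d :=
  fun hs c h0 => relations_le_closure_adjoined d (kernel_iff_summit.2 hs c h0)

/-- **Assembly of the adjoined split**: head cell + Conjecture-1-with-adjoined-`≤ d`-relations ⇒ kernel. -/
theorem xMapKernel_of_headCell_of_adjoined (d : ℕ) (hH : HeadCell d) (hK : AdjoinedKernel d) : XMapKernel := by
  rw [xMapKernel_iff_kernel]
  intro c h0
  rw [← closure_adjoined_eq_relations_of_headCell d hH]
  exact hK c h0

/-- **Assembly into the crux** (the seam is `closure_le`, one `rw`; flagged `trivial_seam`). -/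
theorem remainder_of_headCell_of_adjoined (d : ℕ) : HeadCell d → AdjoinedKernel d → XMapKernelOfCells :=
  fun hH hK _ _ _ => xMapKernel_of_headCell_of_adjoined d hH hK

/-- The adjoined form implies the bridge tail … -/
theorem cofinal_of_adjoined (d : ℕ) : AdjoinedKernel d → Cofinal d :=
  fun hK hH => xMapKernel_of_headCell_of_adjoined d hH hK

/-- … and is the remainder shape `ReducesTo (formalRepLE d)` of census r1 exactly. -/
theorem adjoined_iff_reducesTo (d : ℕ) : AdjoinedKernel d ↔ ReducesTo (KZ.formalRepLE d) := by
  constructor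
  · intro hK c h0
    have hc := hK c h0
    rw [AddSubgroup.closure_union, AddSubgroup.mem_sup] at hc
    obtain ⟨m, hm, k, hk, rfl⟩ := hc
    have hk' : k ∈ KZ.formalRepLE d := by
      refine (AddSubgroup.closure_le _).2 (fun x hx => hx.1) hk
    refine ⟨k, hk', ?_⟩
    rw [add_sub_cancel_right, relations_eq_closure_moves]
    exact hm
  · intro hR c h0
    obtain ⟨c', hc', hcc'⟩ := hR c h0
    have h0' : KZ.eval c' = 0 := by
      have := eval_eq_zero_of_mem_relations hcc'
      rwa [map_sub, h0, zero_sub, neg_eq_zero] at this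
    have hsplit : c = (c - c') + c' := by abel
    rw [hsplit]
    exact AddSubgroup.add_mem _ (relations_le_closure_adjoined d hcc')
      (AddSubgroup.subset_closure (Or.inr ⟨hc', h0'⟩))

/-- **Price of the adjoined split.** The day `HeadCell d` lands, `AdjoinedKernel d` IS the summit. -/
theorem adjoined_iff_summit_of_headCell (d : ℕ) (hH : HeadCell d) :
    AdjoinedKernel d ↔ _root_.KontsevichZagierPeriods :=
  ⟨fun hK => XMapKernelIffSummit.xMapKernel_iff_summit.1 (xMapKernel_of_headCell_of_adjoined d hH hK),
    adjoined_of_summit d⟩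

/-! ## §4 Co-bounded dimension is NOT a proper sector -/

/-- The sector generated by the representations of ambient dimension `≥ d₀`. -/
def coBoundedSector (d₀ : ℕ) : AddSubgroup KZ.FormalRep :=
  AddSubgroup.closure {c | ∃ (n : ℕ) (r : KZ.IntegralRep n), d₀ ≤ n ∧ c = KZ.of r}

/-- Lift every generator `d₀` slabs up (one Newton–Leibniz move per slab). -/
def liftBy (d₀ : ℕ) : KZ.FormalRep →+ KZ.FormalRep :=
  FreeAbelianGroup.lift fun p : Σ n, KZ.IntegralRep n => KZ.of (Classical.choose (p.2.exists_equivalent_add d₀))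

theorem liftBy_of (d₀ : ℕ) {n : ℕ} (r : KZ.IntegralRep n) :
    liftBy d₀ (KZ.of r) = KZ.of (Classical.choose (r.exists_equivalent_add d₀)) :=
  FreeAbelianGroup.lift_apply_of _ _

theorem liftBy_mem_coBounded (d₀ : ℕ) (c : KZ.FormalRep) : liftBy d₀ c ∈ coBoundedSector d₀ := by
  induction c using FreeAbelianGroup.induction_on with
  | zero => simp
  | of p =>
    obtain ⟨n, r⟩ := p
    have h : liftBy d₀ (FreeAbelianGroup.of ⟨n, r⟩) = KZ.of (Classical.choose (r.exists_equivalent_add d₀)) :=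
      liftBy_of d₀ r
    rw [h]
    exact AddSubgroup.subset_closure ⟨n + d₀, _, Nat.le_add_left d₀ n, rfl⟩
  | neg p hp => simpa using AddSubgroup.neg_mem _ hp
  | add x y hx hy => simpa using AddSubgroup.add_mem _ hx hy

theorem sub_liftBy_mem_relations (d₀ : ℕ) (c : KZ.FormalRep) : c - liftBy d₀ c ∈ KZ.relations := by
  induction c using FreeAbelianGroup.induction_on with
  | zero => simp
  | of p =>
    obtain ⟨n, r⟩ := p
    have h : liftBy d₀ (FreeAbelianGroup.of ⟨n, r⟩) = KZ.of (Classical.choose (r.exists_equivalent_add d₀)) :=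
      liftBy_of d₀ r
    rw [h]
    exact Classical.choose_spec (r.exists_equivalent_add d₀)
  | neg p hp =>
    have : -FreeAbelianGroup.of p - liftBy d₀ (-FreeAbelianGroup.of p) = -(FreeAbelianGroup.of p - liftBy d₀ (FreeAbelianGroup.of p)) := by
      rw [map_neg]; abel
    rw [this]
    exact AddSubgroup.neg_mem _ hp
  | add x y hx hy =>
    have : x + y - liftBy d₀ (x + y) = (x - liftBy d₀ x) + (y - liftBy d₀ y) := by
      rw [map_add]; abel
    rw [this]
    exact AddSubgroup.add_mem _ hx hy

/-- **For every `d₀`, Conjecture 1 on the sector of representations of dimension `≥ d₀` is the WHOLE kernel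
conjecture** (hence the summit): "beyond dimension one" cannot be cut off from above; only the
bounded-above sectors `HeadCell d` are proper. -/
theorem coBounded_iff_xMapKernel (d₀ : ℕ) : CellKernel (coBoundedSector d₀) ↔ XMapKernel := by
  refine ⟨fun hC => ?_, fun hX => cellKernel_of_xMapKernel _ hX⟩
  rw [xMapKernel_iff_kernel]
  intro c h0
  have hrel := sub_liftBy_mem_relations d₀ c
  have h0' : KZ.eval (liftBy d₀ c) = 0 := by
    have := eval_eq_zero_of_mem_relations hrel
    rwa [map_sub, h0, zero_sub, neg_eq_zero] at this
  have hsplit : c = (c - liftBy d₀ c) + liftBy d₀ c := by abel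
  rw [hsplit]
  exact AddSubgroup.add_mem _ hrel (hC _ (liftBy_mem_coBounded d₀ c) h0')

theorem coBounded_iff_summit (d₀ : ℕ) : CellKernel (coBoundedSector d₀) ↔ _root_.KontsevichZagierPeriods :=
  (coBounded_iff_xMapKernel d₀).trans XMapKernelIffSummit.xMapKernel_iff_summit

end Summit.KontsevichZagierPeriods.KontsevichZagierPeriods.Cruxes.XMapKernelOfCells.Seams
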